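import Summits.BirchSwinnertonDyer.BirchSwinnertonDyer.Theorems.ByReductionTypeAtTwoAdditivePotGoodLowerHalfOrderWitnessExact
import HarnessLib

/-!
# K4 crux `AdditiveRankZeroAtTwo` (item 19098), child C2″ `AdditivePotGoodReducibleRestAtTwo` (item 22616):
# an EULER-SYSTEM-FREE road into the upper half on the REST classes — on a row with first descent `s ≤ t + 2`
# (Cassels–Tate: `Ш[2^∞] ≅ (ℤ/2^m)²`) the upper half `ord₂ #Ш ≤ ord₂ #Ш_an = 2k` IS «`Ш[2^{k+1}] = Ш[2^k]`», the
# output of a `2^{k+1}`-descent; no Kato member, hence no torsion or parity side condition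

Cell `bsd-2adic`, seat `bsd-2adic-k4-w2` GEN 0; `--supports stmt-BirchSwinnertonDyer-22616 --as helper`; sequel of
`…LowerHalfOrderWitness{,Exact}.lean` (p650635 / p651341). HONEST FRAMING: conditional theorems (published inputs BY NAME +
per-class certificate SLOTS — descent counts and torsion-of-`Ш` equalities, OBJECTS the tree cannot compute); closes
nothing at the `∀`-level; nothing booked; BSD is not proved by any of this.

WHY. C2″ is the UPPER half `MissingUpperBoundAt W 2` on the `E[2]`-reducible additive potentially-good rank-`0` curves
OFF Kato's member sub-block: an isogenous curve with `4 ∣ #tors`, or `ord₂ #Ш_an` odd (route file docstring; addL2x GEN 10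
`missingUpperBoundAt_two_of_katoMember_two` loses exactly `ord₂ #tors(member)`). Census (kits j306106 / j307312): the rest
is 9 + 2 = 11 BIGTORS classes (`max ord₂ #tors = 2`), and 0 members with odd `ord₂ #Ш_an`. On those 11 classes no
Euler-system road is typed. This file types the DESCENT road, which uses neither Kato's member nor any side condition:

* §1 (any abelian group / any `Ш(E/K)`): `Ш[p^{k+1}] = Ш[p^k]` (as an equality of cardinalities of finite subgroups, or
  element-wise) forces `ord_p (ord x) ≤ k` for every `x ∈ Ш` (`padicValNat_addOrderOf_le_of_torsionBy_step`); in rank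
  `0` the two cardinalities are READ OFF the descent counts `#Sel^(p^k)`, `#Sel^(p^{k+1})`, `#E(K)[p^k]`, `#E(K)[p^{k+1}]`
  (`natCard_selmerGroup_eq`, Silverman X.4.2, PROVED in the tree): `natCard_sha_torsionBy_eq_of_selmer_counts`.
* §2 (over `ℚ`): with p651341's `missingUpperBoundAt_of_forall_padicValNat_addOrderOf_le` this gives the upper half
  at a row with `s ≤ t + 2` and `2k ≤ ord_p #Ш_an` from the level-`p^k`/`p^{k+1}` descent counts, and along the class by
  Cassels' transport (`TwistComparison.missingUpperBoundAt_of_isIsogenous`).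
* §3 keyed to C2″: `addPotGoodReducibleRest_two_of_descentCounts_at_member` (C2″ at `W` from the descent certificate
  at ANY globally minimal member `W'`), the `∀`-closure `additivePotGoodReducibleRestAtTwo_of_descentCertificates`
  (C2″ BY NAME from Cassels–Tate + Cassels + GZK + modularity + ONE descent certificate per rest class), and the
  converse bookkeeping `torsionStep_of_missingUpperBoundAt` (the upper half forces `ord₂ (ord x) ≤ a/2` on every
  `x ∈ Ш`, so the certificate asks nothing BSD₂ does not predict: for `#Ш_an = 16`, `Ш[8] = Ш[4]`).

References: [SilvermanAEC2009] Thm. X.4.2, Thm. X.4.14; [Cassels1965ArithmeticVIII] / [MilneADT2006] Thm. I.7.3;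
[Miller2011LMS] Def. 1.1; [Kato2004Asterisque] Thm. 14.5 (what this road does NOT use); [GrossZagier1986], [Kolyvagin1990].
-/

set_option autoImplicit false
set_option linter.dupNamespace false

noncomputable section

open scoped Classical AddSubgroup

/-! ## §1 Torsion steps: `A[p^{k+1}] = A[p^k]` bounds the `p`-adic order of every element -/

namespace Literature.GroupTheory.FiniteAbelian

universe u

/-- **A torsion step bounds every element's `p`-adic order**: in a finite abelian group `A`, if every `x` with
`p^{k+1} • x = 0` already has `p^k • x = 0`, then `ord_p (ord x) ≤ k` for every `x` (else the multiple
`(ord x / p^{k+1}) • x` has order exactly `p^{k+1}`). [folklore] -/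
theorem padicValNat_addOrderOf_le_of_torsionBy_step {A : Type u} [AddCommGroup A] [Finite A] (p : ℕ)
    [hp : Fact p.Prime] {k : ℕ} (hstep : ∀ x : A, p ^ (k + 1) • x = 0 → p ^ k • x = 0) (x : A) :
    padicValNat p (addOrderOf x) ≤ k := by
  by_contra hlt
  rw [not_le] at hlt
  have hx0 : addOrderOf x ≠ 0 := (addOrderOf_pos x).ne'
  have hdvd : p ^ (k + 1) ∣ addOrderOf x := (padicValNat_dvd_iff_le hx0).mpr hlt
  set y : A := (addOrderOf x / p ^ (k + 1)) • x with hy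
  have hord : addOrderOf y = p ^ (k + 1) := addOrderOf_nsmul_addOrderOf_sub hx0 hdvd
  have hyk : p ^ k • y = 0 := hstep y (by rw [← hord]; exact addOrderOf_nsmul_eq_zero y)
  have hdvd' : p ^ (k + 1) ∣ p ^ k := hord ▸ addOrderOf_dvd_of_nsmul_eq_zero hyk
  have hlt' : p ^ k < p ^ (k + 1) := Nat.pow_lt_pow_right hp.out.one_lt (Nat.lt_succ_self k)
  exact absurd (Nat.le_of_dvd (pow_pos hp.out.pos k) hdvd') (not_le.mpr hlt')

/-- **Equal counts ⇒ torsion step**: if the finite subgroups `A[p^{k+1}] ⊇ A[p^k]` have the same cardinality they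
are equal, so every `x` with `p^{k+1} • x = 0` has `p^k • x = 0`. [folklore] -/
theorem torsionBy_step_of_natCard_eq {A : Type u} [AddCommGroup A] (p k : ℕ)
    [Finite (AddSubgroup.torsionBy A ((p ^ (k + 1) : ℕ) : ℤ))]
    (hcard : Nat.card (AddSubgroup.torsionBy A ((p ^ (k + 1) : ℕ) : ℤ)) =
      Nat.card (AddSubgroup.torsionBy A ((p ^ k : ℕ) : ℤ))) :
    ∀ x : A, p ^ (k + 1) • x = 0 → p ^ k • x = 0 := by
  have hle : AddSubgroup.torsionBy A ((p ^ k : ℕ) : ℤ) ≤ AddSubgroup.torsionBy A ((p ^ (k + 1) : ℕ) : ℤ) := by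
    intro x hx
    refine AddSubgroup.torsionBy.nsmul_iff.mpr ?_
    rw [pow_succ, mul_nsmul, AddSubgroup.torsionBy.nsmul_iff.mp hx, nsmul_zero]
  have heq := AddSubgroup.eq_of_le_of_card_ge hle hcard.le
  intro x hx
  have hx' : x ∈ AddSubgroup.torsionBy A ((p ^ (k + 1) : ℕ) : ℤ) := AddSubgroup.torsionBy.nsmul_iff.mpr hx
  rw [← heq] at hx'
  exact AddSubgroup.torsionBy.nsmul_iff.mp hx'

end Literature.GroupTheory.FiniteAbelian

namespace WeierstrassCurve

open Literature.NumberTheory.EllipticCurves Literature.GroupTheory.FiniteAbelian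

universe u

variable {K : Type u} [Field K] [NumberField K]

/-- **`#Ш(E/K)[n]` from the `n`-descent count in rank `0`**: `#Sel^(n) = n^0 · #E(K)[n] · #Ш[n]` (Silverman X.4.2,
the tree's PROVED `natCard_selmerGroup_eq`), so with `#Sel^(n) = p^s`, `#E(K)[n] = p^t`: `#Ш[n] = p^(s - t)` (and
`t ≤ s`). [cite: SilvermanAEC2009, Thm. X.4.2] -/
theorem natCard_sha_torsionBy_eq_of_selmer_count (W : WeierstrassCurve K) [W.IsElliptic] (p : ℕ)
    [hp : Fact p.Prime] (hr : W.mordellWeilRank = 0) {n : ℕ} (hn : n ≠ 0) {s t : ℕ}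
    (hs : Nat.card (W.selmerGroup n) = p ^ s) (ht : Nat.card (W.toAffine.Point[(n : ℤ)]) = p ^ t) :
    Nat.card (AddSubgroup.torsionBy W.sha (n : ℤ)) = p ^ (s - t) ∧ t ≤ s := by
  have hSel := W.natCard_selmerGroup_eq hn
  rw [hs, ht, hr, pow_zero, one_mul, ← Literature.Algebra.Module.natCard_torsionBy_addSubgroup] at hSel
  -- `p ^ s = p ^ t * #Ш[n]`
  have hts : t ≤ s := by
    have h : p ^ t ∣ p ^ s := ⟨_, hSel⟩
    exact (Nat.pow_dvd_pow_iff_le_right hp.out.one_lt).mp h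
  refine ⟨?_, hts⟩
  have hpt : 0 < p ^ t := pow_pos hp.out.pos t
  apply Nat.eq_of_mul_eq_mul_left hpt
  rw [← hSel, ← pow_add, Nat.add_sub_cancel' hts]

/-- **Equal `Ш`-torsion counts at levels `p^k`, `p^{k+1}` from the two descent counts** (rank `0`): if
`#Sel^(p^k) = p^{s₁}`, `#E(K)[p^k] = p^{t₁}`, `#Sel^(p^{k+1}) = p^{s₂}`, `#E(K)[p^{k+1}] = p^{t₂}` and
`s₂ + t₁ = s₁ + t₂`, then `#Ш[p^{k+1}] = #Ш[p^k]`. [cite: SilvermanAEC2009, Thm. X.4.2] -/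
theorem natCard_sha_torsionBy_eq_of_selmer_counts (W : WeierstrassCurve K) [W.IsElliptic] (p : ℕ)
    [hp : Fact p.Prime] (hr : W.mordellWeilRank = 0) (k : ℕ) {s₁ t₁ s₂ t₂ : ℕ}
    (hs₁ : Nat.card (W.selmerGroup (p ^ k)) = p ^ s₁)
    (ht₁ : Nat.card (W.toAffine.Point[((p ^ k : ℕ) : ℤ)]) = p ^ t₁)
    (hs₂ : Nat.card (W.selmerGroup (p ^ (k + 1))) = p ^ s₂)
    (ht₂ : Nat.card (W.toAffine.Point[((p ^ (k + 1) : ℕ) : ℤ)]) = p ^ t₂) (hbal : s₂ + t₁ = s₁ + t₂) :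
    Nat.card (AddSubgroup.torsionBy W.sha ((p ^ (k + 1) : ℕ) : ℤ)) =
      Nat.card (AddSubgroup.torsionBy W.sha ((p ^ k : ℕ) : ℤ)) := by
  have hk0 : p ^ k ≠ 0 := pow_ne_zero k hp.out.ne_zero
  have hk1 : p ^ (k + 1) ≠ 0 := pow_ne_zero (k + 1) hp.out.ne_zero
  obtain ⟨h₁, ht₁s⟩ := natCard_sha_torsionBy_eq_of_selmer_count W p hr hk0 hs₁ ht₁
  obtain ⟨h₂, ht₂s⟩ := natCard_sha_torsionBy_eq_of_selmer_count W p hr hk1 hs₂ ht₂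
  rw [h₁, h₂]
  congr 1
  omega

/-- **The two descent counts bound every element of `Ш`** (finite `Ш`, rank `0`): under the hypotheses of
`natCard_sha_torsionBy_eq_of_selmer_counts`, every `x ∈ Ш(E/K)` has `ord_p (ord x) ≤ k`. No pairing needed.
[cite: SilvermanAEC2009, Thm. X.4.2] -/
theorem forall_padicValNat_addOrderOf_le_of_selmer_counts (W : WeierstrassCurve K) [W.IsElliptic]
    [Finite W.sha] (p : ℕ) [hp : Fact p.Prime] (hr : W.mordellWeilRank = 0) (k : ℕ) {s₁ t₁ s₂ t₂ : ℕ}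
    (hs₁ : Nat.card (W.selmerGroup (p ^ k)) = p ^ s₁)
    (ht₁ : Nat.card (W.toAffine.Point[((p ^ k : ℕ) : ℤ)]) = p ^ t₁)
    (hs₂ : Nat.card (W.selmerGroup (p ^ (k + 1))) = p ^ s₂)
    (ht₂ : Nat.card (W.toAffine.Point[((p ^ (k + 1) : ℕ) : ℤ)]) = p ^ t₂) (hbal : s₂ + t₁ = s₁ + t₂)
    (x : W.sha) : padicValNat p (addOrderOf x) ≤ k :=
  padicValNat_addOrderOf_le_of_torsionBy_step p
    (torsionBy_step_of_natCard_eq p k (natCard_sha_torsionBy_eq_of_selmer_counts W p hr k hs₁ ht₁ hs₂ ht₂ hbal)) x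

end WeierstrassCurve

/-! ## §2 The upper half at a pair over `ℚ` from descent counts, and along the class -/

namespace Summit.BirchSwinnertonDyer.BirchSwinnertonDyer.Theorems

open WeierstrassCurve Literature.NumberTheory.EllipticCurves
  Literature.NumberTheory.EllipticCurves.Rank1Residual
  Literature.NumberTheory.EllipticCurves.Rank1Residual.Typed
  Literature.GroupTheory.FiniteAbelian
  Summit.BirchSwinnertonDyer.Rank1Residual.Additive

section Pair

variable (W : WeierstrassCurve ℚ) [W.IsElliptic] (p : ℕ) [hp : Fact p.Prime]

/-- **The UPPER half at a rank-`0` pair from a torsion step, Euler-system-free**: analytic rank `0` (GZK `hGZK`: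
rank `0`, `Ш` finite), `#Ш(W)[p] ≤ p²`, `#Ш_an(W) = q` with `2k ≤ ord_p q`, and the step
`∀ x ∈ Ш(W), p^{k+1} • x = 0 → p^k • x = 0`: then `MissingUpperBoundAt W p`. Conditional on `hCT`, `hGZK` and the two
slots. [cite: SilvermanAEC2009, Thm. X.4.14] [cite: Miller2011LMS, Def. 1.1] -/
theorem missingUpperBoundAt_of_torsionBy_step (hCT : exists_casselsTate_pairing (K := ℚ))
    (hGZK : rank_eq_analyticRank_of_analyticRank_le_one) (hr : W.analyticRank ≤ 1)
    (hSha : Nat.card (AddSubgroup.torsionBy W.sha (p : ℤ)) ≤ p ^ 2) {q : ℚ} (hq : shaAn W = (q : ℂ))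
    {k : ℕ} (hkq : ((2 * k : ℕ) : ℤ) ≤ padicValRat p q)
    (hstep : ∀ x : W.sha, p ^ (k + 1) • x = 0 → p ^ k • x = 0) : MissingUpperBoundAt W p := by
  haveI : Finite W.sha := (hGZK W hr).2
  exact missingUpperBoundAt_of_forall_padicValNat_addOrderOf_le W p hCT hGZK hr hSha hq hkq
    (padicValNat_addOrderOf_le_of_torsionBy_step p hstep)

/-- **The UPPER half at a rank-`0` pair from THREE descent counts** (levels `p`, `p^k`, `p^{k+1}`), Euler-system-free:
analytic rank `0`; `#Sel^(p) = p^s`, `#W(ℚ)[p] = p^t`, `s ≤ t + 2` (first descent); the level-`p^k` and `p^{k+1}` counts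
balanced (`s₂ + t₁ = s₁ + t₂`, i.e. `#Ш[p^{k+1}] = #Ш[p^k]`); `#Ш_an(W) = q` with `2k ≤ ord_p q`. Then
`ord_p #Ш(W) ≤ ord_p #Ш_an(W)`. Conditional on `hCT`, `hGZK` and the descent slots.
[cite: SilvermanAEC2009, Thm. X.4.2 and Thm. X.4.14] [cite: Miller2011LMS, Def. 1.1] -/
theorem missingUpperBoundAt_of_descentCounts (hCT : exists_casselsTate_pairing (K := ℚ))
    (hGZK : rank_eq_analyticRank_of_analyticRank_le_one) (hr : W.analyticRank = 0) {s t : ℕ}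
    (hs : Nat.card (W.selmerGroup p) = p ^ s) (ht : Nat.card (W.toAffine.Point[(p : ℤ)]) = p ^ t)
    (hst : s ≤ t + 2) (k : ℕ) {s₁ t₁ s₂ t₂ : ℕ} (hs₁ : Nat.card (W.selmerGroup (p ^ k)) = p ^ s₁)
    (ht₁ : Nat.card (W.toAffine.Point[((p ^ k : ℕ) : ℤ)]) = p ^ t₁)
    (hs₂ : Nat.card (W.selmerGroup (p ^ (k + 1))) = p ^ s₂)
    (ht₂ : Nat.card (W.toAffine.Point[((p ^ (k + 1) : ℕ) : ℤ)]) = p ^ t₂) (hbal : s₂ + t₁ = s₁ + t₂)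
    {q : ℚ} (hq : shaAn W = (q : ℂ)) (hkq : ((2 * k : ℕ) : ℤ) ≤ padicValRat p q) :
    MissingUpperBoundAt W p := by
  have hr1 : W.analyticRank ≤ 1 := by rw [hr]; exact zero_le_one
  haveI : Finite W.sha := (hGZK W hr1).2
  have hrk : W.mordellWeilRank = 0 := by rw [(hGZK W hr1).1, hr]
  exact missingUpperBoundAt_of_forall_padicValNat_addOrderOf_le W p hCT hGZK hr1
    (natCard_sha_torsionBy_le_of_selmer_count W p hrk hs (by convert ht using 4; convert Iff.rfl) hst) hq hkq
    (forall_padicValNat_addOrderOf_le_of_selmer_counts W p hrk k hs₁ (by convert ht₁ using 4; convert Iff.rfl) hs₂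
      (by convert ht₂ using 4; convert Iff.rfl) hbal)

/-- **Conversely the upper half forces the bound on every element** (no slot needed for this direction): in
analytic rank `≤ 1`, `MissingUpperBoundAt W p` with `#Ш_an(W) = q`, `ord_p q ≤ 2k` (+1 allowed: `< 2k + 2`) gives
`ord_p (ord x) ≤ k` for all `x ∈ Ш(W)` — p650635's `(ord x)² ∣ #Ш`. So on a row with `ord_p #Ш_an = 2k` the
descent certificate «`Ш[p^{k+1}] = Ш[p^k]`» asks exactly what BSD_p predicts. Conditional on `hCT`, `hGZK`.
[cite: SilvermanAEC2009, Thm. X.4.14] [cite: Miller2011LMS, Def. 1.1] -/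
theorem forall_padicValNat_addOrderOf_le_of_missingUpperBoundAt (hCT : exists_casselsTate_pairing (K := ℚ))
    (hGZK : rank_eq_analyticRank_of_analyticRank_le_one) (hr : W.analyticRank ≤ 1)
    (h : MissingUpperBoundAt W p) {q : ℚ} (hq : shaAn W = (q : ℂ)) {k : ℕ}
    (hqk : padicValRat p q < ((2 * k + 2 : ℕ) : ℤ)) (x : W.sha) : padicValNat p (addOrderOf x) ≤ k := by
  haveI : Finite W.sha := (hGZK W hr).2
  obtain ⟨q', hq', hge⟩ := h
  have hqq : q' = q := by exact_mod_cast hq'.symm.trans hq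
  subst hqq
  have h2 := two_mul_padicValNat_addOrderOf_le_padicValNat_shaOrder_of_casselsTate hCT W p x
  have h3 : ((padicValNat p W.shaOrder : ℕ) : ℤ) < ((2 * k + 2 : ℕ) : ℤ) := lt_of_le_of_lt hge hqk
  have h4 : padicValNat p W.shaOrder < 2 * k + 2 := by exact_mod_cast h3
  omega

end Pair

end Summit.BirchSwinnertonDyer.BirchSwinnertonDyer.Theorems

/-! ## §3 Keyed to C2″ `AdditivePotGoodReducibleRestAtTwo`: the rest classes from ONE descent certificate each -/

namespace Summit.BirchSwinnertonDyer.BirchSwinnertonDyer.Theorems.AddKatoTwo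

open WeierstrassCurve Literature.NumberTheory.EllipticCurves
  Literature.NumberTheory.EllipticCurves.Rank1Residual
  Literature.NumberTheory.EllipticCurves.Rank1Residual.Typed
  Summit.BirchSwinnertonDyer.BirchSwinnertonDyer.Theorems
  Summit.BirchSwinnertonDyer.Rank1Residual.Additive
  Summit.BirchSwinnertonDyer.BirchSwinnertonDyer.Theses.ByReductionTypeAtTwo

/-- **C2″ at `W` from a descent certificate at ANY globally minimal member `W'` of its class.** Binders of the child
verbatim (`W` globally minimal, non-CM, analytic rank `0`, additive and potentially good at `2`, `E[2]` reducible, OFF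
Kato's member sub-block — all carried, none used: this road has no side condition), plus at `W' ∼_ℚ W`: the first
descent `#Sel₂ = 2^s`, `#W'(ℚ)[2] = 2^t`, `s ≤ t + 2`; the level-`2^k`/`2^{k+1}` counts balanced; `#Ш_an(W') = q'` with
`2k ≤ ord₂ q'`. Then `MissingUpperBoundAt W 2` (§2 at `W'`, then Cassels' transport of the upper half,
`TwistComparison.missingUpperBoundAt_of_isIsogenous`). For the 11 BIGTORS census classes (`ord₂ #Ш_an = 4`): `k = 2`,
an `8`-descent showing `#Ш[8] = #Ш[4]`. Conditional on `hCT`, Cassels `hCassels`, `hGZK`, modularity `hmod` and the slots.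
[cite: SilvermanAEC2009, Thm. X.4.2 and Thm. X.4.14] [cite: MilneADT2006, Thm. I.7.3] [cite: Miller2011LMS, Def. 1.1] -/
theorem addPotGoodReducibleRest_two_of_descentCounts_at_member (hCT : exists_casselsTate_pairing (K := ℚ))
    (hCassels : bsdRHS_eq_of_isIsogenous) (hGZK : rank_eq_analyticRank_of_analyticRank_le_one)
    (hmod : hasEntireLFunction_rat) (W : WeierstrassCurve ℚ) [W.IsElliptic] [W.IsGloballyMinimal]
    (_hcm : ¬ W.HasCM) (hr : W.analyticRank = 0) (_hadd : Addv W 2) (_hj : 0 ≤ padicValRat 2 W.j)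
    (_hred : ¬ W.HasIrreducibleModPGaloisRep 2)
    (_hrest : ¬ ((∀ (W'' : WeierstrassCurve ℚ) [W''.IsElliptic], IsIsogenous W W'' → ¬ 2 ^ 2 ∣ W''.torsionOrder) ∧
      (∀ q : ℚ, shaAn W = (q : ℂ) → Even (padicValRat 2 q))))
    (W' : WeierstrassCurve ℚ) [W'.IsElliptic] [W'.IsGloballyMinimal] (hiso : IsIsogenous W W') {s t : ℕ}
    (hs : Nat.card (W'.selmerGroup 2) = 2 ^ s) (ht : Nat.card (W'.toAffine.Point[(2 : ℤ)]) = 2 ^ t)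
    (hst : s ≤ t + 2) (k : ℕ) {s₁ t₁ s₂ t₂ : ℕ} (hs₁ : Nat.card (W'.selmerGroup (2 ^ k)) = 2 ^ s₁)
    (ht₁ : Nat.card (W'.toAffine.Point[((2 ^ k : ℕ) : ℤ)]) = 2 ^ t₁)
    (hs₂ : Nat.card (W'.selmerGroup (2 ^ (k + 1))) = 2 ^ s₂)
    (ht₂ : Nat.card (W'.toAffine.Point[((2 ^ (k + 1) : ℕ) : ℤ)]) = 2 ^ t₂) (hbal : s₂ + t₁ = s₁ + t₂)
    {q' : ℚ} (hq' : shaAn W' = (q' : ℂ)) (hkq : ((2 * k : ℕ) : ℤ) ≤ padicValRat 2 q') :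
    MissingUpperBoundAt W 2 := by
  haveI : Fact (Nat.Prime 2) := ⟨Nat.prime_two⟩
  have hr' : W'.analyticRank = 0 := by rw [← analyticRank_eq_of_isIsogenous' hiso, hr]
  have hr1' : W'.analyticRank ≤ 1 := by rw [hr']; exact zero_le_one
  exact TwistComparison.missingUpperBoundAt_of_isIsogenous W' W 2 hCassels hGZK hmod hiso.symm_of_charZero hr1'
    (missingUpperBoundAt_of_descentCounts W' 2 hCT hGZK hr' hs (by simpa only [Nat.cast_ofNat] using ht) hst k hs₁
      ht₁ hs₂ ht₂ hbal hq' hkq)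

/-- **C2″ `AdditivePotGoodReducibleRestAtTwo` from Cassels–Tate, Cassels, GZK, modularity and ONE DESCENT CERTIFICATE PER
REST CLASS**, Euler-system-free. `hcert`: for every row of the child, SOME globally minimal member `W'` of its class
carries the first descent (`s ≤ t + 2`), balanced level-`2^k`/`2^{k+1}` counts and `2k ≤ ord₂ #Ш_an(W')`. This displays the
rest of the reducible block in certificate currency (census: 11 BIGTORS classes, `k = 2`: «`#Sel₈ · #E(ℚ)[4] = #Sel₄ · #E(ℚ)[8]`»
at one member); class-wide `hcert` is NOT a theorem of print and the tree cannot compute it; the item is NOT closed.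
Conditional on the four published facts and the slots. [cite: SilvermanAEC2009, Thm. X.4.2 and Thm. X.4.14]
[cite: MilneADT2006, Thm. I.7.3] [cite: Miller2011LMS, Def. 1.1] -/
theorem additivePotGoodReducibleRestAtTwo_of_descentCertificates (hCT : exists_casselsTate_pairing (K := ℚ))
    (hCassels : bsdRHS_eq_of_isIsogenous) (hGZK : rank_eq_analyticRank_of_analyticRank_le_one)
    (hmod : hasEntireLFunction_rat)
    (hcert : ∀ (W : WeierstrassCurve ℚ) [W.IsElliptic] [W.IsGloballyMinimal], ¬ W.HasCM → W.analyticRank = 0 →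
      Addv W 2 → 0 ≤ padicValRat 2 W.j → ¬ W.HasIrreducibleModPGaloisRep 2 →
      ∃ (W' : WeierstrassCurve ℚ) (_ : W'.IsElliptic) (_ : W'.IsGloballyMinimal), IsIsogenous W W' ∧
        ∃ (s t k s₁ t₁ s₂ t₂ : ℕ) (q' : ℚ),
          Nat.card (W'.selmerGroup 2) = 2 ^ s ∧ Nat.card (W'.toAffine.Point[(2 : ℤ)]) = 2 ^ t ∧ s ≤ t + 2 ∧
          Nat.card (W'.selmerGroup (2 ^ k)) = 2 ^ s₁ ∧ Nat.card (W'.toAffine.Point[((2 ^ k : ℕ) : ℤ)]) = 2 ^ t₁ ∧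
          Nat.card (W'.selmerGroup (2 ^ (k + 1))) = 2 ^ s₂ ∧
          Nat.card (W'.toAffine.Point[((2 ^ (k + 1) : ℕ) : ℤ)]) = 2 ^ t₂ ∧ s₂ + t₁ = s₁ + t₂ ∧
          shaAn W' = (q' : ℂ) ∧ ((2 * k : ℕ) : ℤ) ≤ padicValRat 2 q') :
    AdditivePotGoodReducibleRestAtTwo := by
  intro W _ _ hcm hr hadd hj hred hrest
  obtain ⟨W', hW'e, hW'm, hiso, s, t, k, s₁, t₁, s₂, t₂, q', hs, ht, hst, hs₁, ht₁, hs₂, ht₂, hbal, hq', hkq⟩ :=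
    hcert W hcm hr hadd hj hred
  haveI := hW'e
  haveI := hW'm
  exact addPotGoodReducibleRest_two_of_descentCounts_at_member hCT hCassels hGZK hmod W hcm hr hadd hj hred hrest W' hiso
    hs ht hst k hs₁ ht₁ hs₂ ht₂ hbal hq' hkq

/-- **The certificate asks nothing BSD₂ does not predict**: conversely, on a row of C2″ with `#Ш_an(W) = q`,
`ord₂ q < 2k + 2`, the child's conclusion `MissingUpperBoundAt W 2` forces `ord₂ (ord x) ≤ k` for every `x ∈ Ш(W)` —
so for the census rest (`#Ш_an = 16`, `k = 2`) the `8`-descent certificate `Ш[8] = Ш[4]` is implied by the crux.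
Conditional on `hCT`, `hGZK`. [cite: SilvermanAEC2009, Thm. X.4.14] [cite: Miller2011LMS, Def. 1.1] -/
theorem torsionStep_of_additivePotGoodReducibleRestAtTwo (hCT : exists_casselsTate_pairing (K := ℚ))
    (hGZK : rank_eq_analyticRank_of_analyticRank_le_one) (h : AdditivePotGoodReducibleRestAtTwo)
    (W : WeierstrassCurve ℚ) [W.IsElliptic] [W.IsGloballyMinimal] (hcm : ¬ W.HasCM) (hr : W.analyticRank = 0)
    (hadd : Addv W 2) (hj : 0 ≤ padicValRat 2 W.j) (hred : ¬ W.HasIrreducibleModPGaloisRep 2)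
    (hrest : ¬ ((∀ (W'' : WeierstrassCurve ℚ) [W''.IsElliptic], IsIsogenous W W'' → ¬ 2 ^ 2 ∣ W''.torsionOrder) ∧
      (∀ q : ℚ, shaAn W = (q : ℂ) → Even (padicValRat 2 q))))
    {q : ℚ} (hq : shaAn W = (q : ℂ)) {k : ℕ} (hqk : padicValRat 2 q < ((2 * k + 2 : ℕ) : ℤ)) (x : W.sha) :
    padicValNat 2 (addOrderOf x) ≤ k :=
  haveI : Fact (Nat.Prime 2) := ⟨Nat.prime_two⟩
  forall_padicValNat_addOrderOf_le_of_missingUpperBoundAt W 2 hCT hGZK (by rw [hr]; exact zero_le_one)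
    (h W hcm hr hadd hj hred hrest) hq hqk x

end Summit.BirchSwinnertonDyer.BirchSwinnertonDyer.Theorems.AddKatoTwo

end
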